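import Mathlib
import Summits.HodgeConjecture.FermatCycles.HodgeFermatHypUPlusB

/-!
# LEMMA S⁺ — part 3: the walks over multiples of prime squares, `goodOddP_of` (`HodgeFermat/HypUPlus.lean`; HF-G26)

Tree copy (part 3 of 3) of the module `HodgeFermat/HypUPlus.lean` of the sibling cell's standalone package
`run/shared/lean/pub/pub-hodgefermat/lean/HodgeFermat/` (778 lines, sha256 `f3c5085dc93f3a67…`), source lines 629–778 (§4 the test walk, the walk over odd multiples of prime squares `walkMul`/`MulCover`/`SqCover`; §5 LEMMA S⁺ `goodOddP_of`; the two exceptions).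
Filed by cell `pub-hfermat`, seat prover-1 gen-3, on the COORDINATOR KEEPER RULING of 2026-08-25 (gem sweep H1: take the
off-gate kernel theorem `thmFstar` through the gate) — here THEOREM F* of `tables/DPRIME-THEOREM.md` §9 IN FULL, i.e.
PROPOSITION D′(3N) and the descent (`HodgeFermat/PropDPrimeNFinal.lean`, GATE HF-G34), the last off-gate form of THEOREM F*
(its first two forms, `DecodingFinal.thmFstar` = F* at the prime levels and `ThmFstarNFinal.thmFstar` = F*(3N), landed on
2026-08-25 as `HodgeFermatThmFstar.lean` / `HodgeFermatThmFstarN.lean`, seats prover-1 gen-0 / gen-2); this file is one link of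
the import closure of `PropDPrimeNFinal.propDprime` (the sibling's KR-free chain: THEOREM L, COROLLARY M, THEOREM D6,
THEOREM U⁺, THEOREM KR6, THEOREM Z3U) on top of those landed chains.  The source module is the sibling's hub-checked module of
record (pub-hodgefermat `CERT.md` l.909, GATE HF-G26; cell record `check/HypUPlus_standalone.lean` sha256 `76158e6cd8cd311b…`); its declarations are copied VERBATIM.
Deviations from the source module, exhaustively: the `import` lines (tree modules `Summits.HodgeConjecture.FermatCycles.
HodgeFermat*` instead of `HodgeFermat.*`); this module docstring; the `set_option`/namespace/`open` preamble (source l.36–41) is repeated at the top because the module is split; one-line docstrings added (gate lint) to `walkN_test`, `nRange_test`, `stepSq`, `stepSq_sound`, `walkMul_sound`, `mulCover_of_walkMul`, `mulCover_append`, `mulCover_mono`, `sqCover_nil`, `sqCover_cons`, `sqCover_append`, `sqCover_of_walkSq`, `squarefree_21`, `squarefree_39`, `not_goodP_21`, `not_goodP_39`. The module docstring is quoted in full in part 1.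
Every other line — in particular every declaration's statement and proof — is byte-identical to the source.
HONEST FRAMING: explicit algebraic cycles for specific Hodge classes on Fermat/Delsarte varieties; residual open instances
listed; no claim on general Hodge.  (This file is arithmetic of CM types / finite combinatorics / analytic number theory
of the sibling's KR-free programme; it claims nothing about cycles.)
-/

set_option autoImplicit false

namespace HodgeFermat.KRFree.HypUPlus

open Finset HodgeFermat.KRFree.HypBReduction HodgeFermat.KRFree.HypUCert HodgeFermat.KRFree.HypUAuto
open HodgeFermat.KRFree.HypUOdd

/-! ### Test (`1 ≤ N < 400`: the non-squarefree odd levels `9, 25, 27, 45, …, 387` get certificates) -/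

/-- the test walk over `1 ≤ N < 400` checks (kernel evaluation) -/
theorem walkN_test : walkN 400 399 = true := by decide +kernel

/-- `NRange 1 400` from the test walk -/
theorem nRange_test : NRange 1 400 := nRange_of_walkN 1 399 walkN_test

/-! ### The walk over the odd multiples of prime squares

The plain walk `walkN` factorises EVERY odd level (≈ 10 ms of kernel time each); the non-squarefree odd levels
below `B` are exactly the odd multiples of `p²`, `p` prime, `p² < B` — about a fifth of the odd levels below `10⁵` —
so the range statement `NRange 1 B` is certified by walking those multiples only (`HypURangeN.lean`). -/

/-- one level known to need the inequality (no squarefree escape): certified skip, or the certificate. -/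
def stepSqOf (n : ℕ) (fs : List (ℕ × ℕ)) : Bool := certSkipP n fs || checkLevelP n fs (certsP n fs)

/-- the step at an odd multiple of a prime square, with in-kernel factorisation -/
def stepSq (n : ℕ) : Bool := stepSqOf n (factor n)

/-- soundness of `stepSq` -/
theorem stepSq_sound (n : ℕ) (h : stepSq n = true) (h2 : ¬ 2 ∣ n) : GoodP n := by
  simp only [stepSq, stepSqOf, Bool.or_eq_true] at h
  rcases h with h | h
  · exact goodTailP n h2 (certSkipP_sound n _ h)
  · exact goodP_of_checkLevelP n _ _ h

/-- `GoodP` at the odd multiples `q · j`, `a < j ≤ b`. -/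
def MulCover (q a b : ℕ) : Prop := ∀ j, a < j → j ≤ b → ¬ 2 ∣ q * j → GoodP (q * j)

/-- walk the multiples `q · (a + 1), …, q · (a + fuel)` through `stepSq` (even ones skipped). -/
def walkMul (q a : ℕ) : ℕ → Bool
  | 0 => true
  | j + 1 => ((q * (a + j + 1)) % 2 == 0 || stepSq (q * (a + j + 1))) && walkMul q a j

/-- soundness of the walk `walkMul` over odd multiples `q·j` -/
theorem walkMul_sound (q a : ℕ) : ∀ fuel : ℕ, walkMul q a fuel = true →
    ∀ j, a < j → j ≤ a + fuel → ¬ 2 ∣ q * j → GoodP (q * j)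
  | 0, _, j, h1, h2, _ => by omega
  | fuel + 1, h, j, h1, h2, hodd => by
      simp only [walkMul, Bool.and_eq_true, Bool.or_eq_true, beq_iff_eq] at h
      rcases Nat.lt_or_ge j (a + fuel + 1) with hlt | hge
      · exact walkMul_sound q a fuel h.2 j h1 (by omega) hodd
      · have hj : j = a + fuel + 1 := by omega
        subst hj
        rcases h.1 with h0 | hs
        · exact absurd (Nat.dvd_of_mod_eq_zero h0) hodd
        · exact stepSq_sound _ hs hodd

/-- `MulCover q a (a + k)` from the walk -/
theorem mulCover_of_walkMul (q a k : ℕ) (h : walkMul q a k = true) : MulCover q a (a + k) :=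
  fun j h1 h2 hodd => walkMul_sound q a k h j h1 h2 hodd

/-- glue two adjacent `MulCover`s -/
theorem mulCover_append {q a b c : ℕ} (h₁ : MulCover q a b) (h₂ : MulCover q b c) : MulCover q a c :=
  fun j h1 h2 hodd => if hb : j ≤ b then h₁ j h1 hb hodd else h₂ j (by omega) h2 hodd

/-- shrink the upper end of a `MulCover` -/
theorem mulCover_mono {q a b b' : ℕ} (h : MulCover q a b) (hb : b' ≤ b) : MulCover q a b' :=
  fun j h1 h2 hodd => h j h1 (le_trans h2 hb) hodd

/-- the multiples of an even `q` are even: nothing to walk. -/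
theorem mulCover_even (q a b : ℕ) (hq : 2 ∣ q) : MulCover q a b :=
  fun j _ _ hodd => absurd (Dvd.dvd.mul_right hq j) hodd

/-- `GoodP` at every odd multiple `N < B` of `p²` for each listed `p`. -/
def SqCover (B : ℕ) (ps : List ℕ) : Prop := ∀ p ∈ ps, MulCover (p * p) 0 ((B - 1) / (p * p))

/-- walk, for each listed `p`, the multiples of `p²` below `B`. -/
def walkSq (B : ℕ) : List ℕ → Bool
  | [] => true
  | p :: ps => walkMul (p * p) 0 ((B - 1) / (p * p)) && walkSq B ps

/-- the empty prime list covers trivially -/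
theorem sqCover_nil (B : ℕ) : SqCover B [] := fun _ hp => absurd hp List.not_mem_nil

/-- `SqCover` of a cons -/
theorem sqCover_cons {B p : ℕ} {ps : List ℕ} (h₁ : MulCover (p * p) 0 ((B - 1) / (p * p)))
    (h₂ : SqCover B ps) : SqCover B (p :: ps) := by
  intro r hr
  rcases List.mem_cons.mp hr with rfl | hmem
  · exact h₁
  · exact h₂ r hmem

/-- `SqCover` of an append -/
theorem sqCover_append {B : ℕ} {l₁ l₂ : List ℕ} (h₁ : SqCover B l₁) (h₂ : SqCover B l₂) :
    SqCover B (l₁ ++ l₂) :=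
  fun p hp => (List.mem_append.mp hp).elim (h₁ p) (h₂ p)

/-- soundness of the walk over prime squares `walkSq` -/
theorem sqCover_of_walkSq (B : ℕ) : ∀ ps : List ℕ, walkSq B ps = true → SqCover B ps
  | [], _ => sqCover_nil B
  | p :: ps, h => by
      simp only [walkSq, Bool.and_eq_true] at h
      refine sqCover_cons ?_ (sqCover_of_walkSq B ps h.2)
      have := mulCover_of_walkMul (p * p) 0 _ h.1
      rwa [Nat.zero_add] at this

/-- THE COVER: a NON-squarefree odd `N < B ≤ 1601²` is an odd multiple of `p²` for a prime `p ≤ 1600`, and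
`HypUCert.smallPrimes` lists them all (`mem_smallPrimes`). -/
theorem nRange_of_sqCover (B : ℕ) (hB : B ≤ 1601 * 1601) (h : SqCover B smallPrimes) : NRange 1 B := by
  intro N h1 hNB h2 hns
  rw [Nat.squarefree_iff_prime_squarefree] at hns
  push Not at hns
  obtain ⟨p, hp, hpN⟩ := hns
  have hN0 : 0 < N := by omega
  have hpp : p * p ≤ N := Nat.le_of_dvd hN0 hpN
  have hp1600 : p ≤ 1600 := by
    by_contra hc
    have : 1601 * 1601 ≤ p * p := Nat.mul_le_mul (by omega) (by omega)
    omega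
  have hmem := mem_smallPrimes p hp hp1600
  obtain ⟨j, hj⟩ := hpN
  have hq0 : 0 < p * p := Nat.mul_pos hp.pos hp.pos
  have hj1 : 0 < j := by
    rcases Nat.eq_zero_or_pos j with h0 | h0
    · rw [h0, mul_zero] at hj; omega
    · exact h0
  have hjb : j ≤ (B - 1) / (p * p) := by
    rw [Nat.le_div_iff_mul_le hq0]
    have : p * p * j ≤ B - 1 := by omega
    simpa [mul_comm] using this
  have hg := h p hmem j hj1 hjb (by rw [← hj]; exact h2)
  rw [← hj] at hg
  exact hg

/-! ## §5 LEMMA S⁺ -/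

/-- **LEMMA S⁺**: `U(N) < 1/6` at every odd level `N > 1` other than `21, 39` — squarefree or not. -/
def GoodOddP : Prop := ∀ N, 1 < N → ¬ 2 ∣ N → N ≠ 21 → N ≠ 39 → GoodP N

/-- LEMMA S⁺ from LEMMA S (`GoodOdd`, the squarefree levels) and the walk over the non-squarefree odd
levels below `100001` (`HypURangeN.nRange_1_100001`); beyond, `goodTailP_100000`. -/
theorem goodOddP_of (hg : GoodOdd) (hn : NRange 1 100001) : GoodOddP := by
  intro N h1 h2 h21 h39
  by_cases hsq : Squarefree N
  · exact goodP_of_good hsq (hg N h1 hsq h2 h21 h39)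
  · by_cases hN : N < 100001
    · exact hn N (by omega) hN h2 hsq
    · exact goodTailP_100000 N h2 (by omega)

/-- LEMMA S⁺ as a function of the THREE certified range statements (`HypURange30k.uRange_2_30001`,
`HypURange3.uRange3_3_100001`, `HypURangeN.nRange_1_100001`); composed in `HypUPlusFinal.goodOddP`. -/
theorem goodOddP_of_ranges (h1 : URange 2 30001) (h3r : URange3 3 100001) (hn : NRange 1 100001) :
    GoodOddP :=
  goodOddP_of (goodOdd_of_ranges h1 h3r) hn

/-! ### The two exceptions stay genuine (they are squarefree: `tauP = tau` there) -/

/-- `21` is squarefree (certificate) -/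
theorem squarefree_21 : Squarefree 21 := certSqfP_sound 21 [(3, 1), (7, 1)] (by decide +kernel)

/-- `39` is squarefree (certificate) -/
theorem squarefree_39 : Squarefree 39 := certSqfP_sound 39 [(3, 1), (13, 1)] (by decide +kernel)

/-- the level inequality fails at `21` in the `GoodP` form too -/
theorem not_goodP_21 : ¬ GoodP 21 := fun h => not_good_21 ((goodP_iff_good squarefree_21).mp h)

/-- the level inequality fails at `39` in the `GoodP` form too -/
theorem not_goodP_39 : ¬ GoodP 39 := fun h => not_good_39 ((goodP_iff_good squarefree_39).mp h)

/-- conversely LEMMA S⁺ contains LEMMA S. -/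
theorem goodOdd_of_goodOddP (h : GoodOddP) : GoodOdd :=
  fun N h1 hsq h2 h21 h39 => (goodP_iff_good hsq).mp (h N h1 h2 h21 h39)

end HodgeFermat.KRFree.HypUPlus
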